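import Literature.AnabelianGeometry.EtaleTheta.Discharge.Sec2ModelKummerLifting
import HarnessLib

/-!
# [EtTh] §2 discharge for the §1 MODEL: coefficient automorphisms induced on `(l·Δ_Θ) ⊗ ℤ/M`
# (Cor. 2.18 (i) ⇒ the hypothesis `γ̄_M` of Cor. 2.19 (iii)), and the constant-multiple-rigidity
# input `hcoll` of Cor. 2.18 (iv) from the named fact `ThetaEnvTower.Cor219_iii`

Mochizuki, *The Étale Theta Function …* [EtTh], Publ. RIMS 45 (2009), §2: Cor. 2.18 (i), (iv)
pp.60–62, Cor. 2.19 (iii) p.65 (locators `p.N` = PDF pages of the PRIMS text; bib key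
`MochizukiEtTh2009`). PROOF-ONLY companion (no `def`, no new named fact; seat abc-iut-L2-d1, DAG node
`EtTh:Cor2.19`, LONG-CHAINS lane C2) of `ThetaRigidity.lean` / `ThetaSystems.lean` (abc-iut-L2-t2) and
of abc-iut-L2-t8's instantiation (`RigidOfSetting.lean`, `TowerOfSetting.lean`).

* `RigidData.exists_mulEquiv_thetaMod_comp` (generic): an automorphism `γ` of `Π^tp_X` preserving
  `Ker(Π^tp_X ↠ (Π^tp_X)^Θ)` and the inverse image of `l·Δ_Θ` (two of the subquotients of Cor. 2.18
  (i)) INDUCES an automorphism `γ̄` of `μ_N ≅ (l·Δ_Θ) ⊗ ℤ/N` through `thetaMod` — because the kernel of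
  `thetaMod` is `Ker · (N-th powers)` (`RigidData.thetaMod_ker`, "`l·Δ_Θ ≅ Ẑ(1)` torsion-free
  procyclic"), which any such `γ` preserves;
* `DoubleUnderline.exists_coeffAut_family`: hence, for the §1 model, Cor. 2.18 (i) supplies at every
  level `M ∈ E` the coefficient automorphisms `γ̄_M` that abc-iut-L2-t2's `ThetaEnvTower.Cor219_iii`
  quantifies over;
* `DoubleUnderline.hcoll_of_cor219_iii`: for the §1 model tower, the NAMED FACT
  `ThetaEnvTower.Cor219_iii` (Cor. 2.19 (iii), functoriality / constant multiple rigidity of the theta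
  collection, FACT row 40 = [EtTh] Thm. 1.6 behind it) together with Cor. 2.18 (i) yields, at every
  level, the collection-stability hypothesis `hcoll` of abc-iut-L2-t10's `cor218_iv_surjective_of`
  (Cor. 2.18 (iv), surjectivity) in its literal cocycle form — so the last RAW binder of the Cor. 2.19
  (ii) model chain becomes a named fact.

HONEST FRAMING: conditional reductions between named facts; no side is taken on [IUTchIII] Cor. 3.12;
typed ≠ discharged elsewhere.
-/

noncomputable section

namespace Literature.AnabelianGeometry.EtaleTheta

open Literature.AnabelianGeometry.SemiGraphs

universe u

namespace RigidData

variable {N : ℕ+} {l : ℕ} (R : RigidData.{u} N l)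

/-- Membership transport along an automorphism preserving a subgroup.
[cite: MochizukiEtTh2009, Cor 2.18 (i) p.60] -/
theorem apply_mem_of_map_eq (γ : R.PiX ≃* R.PiX) {H : Subgroup R.PiX}
    (hH : H.map γ.toMonoidHom = H) {g : R.PiX} (hg : g ∈ H) : γ g ∈ H := by
  rw [← hH]
  exact ⟨g, hg, rfl⟩

/-- … and along its inverse. [cite: MochizukiEtTh2009, Cor 2.18 (i) p.60] -/
theorem symm_apply_mem_of_map_eq (γ : R.PiX ≃* R.PiX) {H : Subgroup R.PiX}
    (hH : H.map γ.toMonoidHom = H) {g : R.PiX} (hg : g ∈ H) : γ.symm g ∈ H := by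
  have hg' : g ∈ H.map γ.toMonoidHom := by rw [hH]; exact hg
  obtain ⟨g₀, hg₀, hg₀eq⟩ := hg'
  have : γ.symm g = g₀ := by
    rw [← hg₀eq]
    exact γ.symm_apply_apply g₀
  rw [this]
  exact hg₀

/-- A subgroup preserved by `γ` is preserved by `γ⁻¹`. [cite: MochizukiEtTh2009, Cor 2.18 (i) p.60] -/
theorem map_symm_eq_of_map_eq (γ : R.PiX ≃* R.PiX) {H : Subgroup R.PiX}
    (hH : H.map γ.toMonoidHom = H) : H.map γ.symm.toMonoidHom = H := by
  ext g
  constructor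
  · rintro ⟨h, hh, rfl⟩
    exact R.symm_apply_mem_of_map_eq γ hH hh
  · intro hg
    exact ⟨γ g, R.apply_mem_of_map_eq γ hH hg, γ.symm_apply_apply g⟩

/-- The kernel of `thetaMod : (l·Δ_Θ)~ ↠ μ_N` (`= Ker(Π^tp_X ↠ (Π^tp_X)^Θ) · (N-th powers)`,
`thetaMod_ker`) is stable under every automorphism of `Π^tp_X` preserving `Ker(Π^tp_X ↠ (Π^tp_X)^Θ)`
and the inverse image of `l·Δ_Θ`. [cite: MochizukiEtTh2009, Cor 2.18 (i) p.60] -/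
theorem thetaMod_apply_eq_one (γ : R.PiX ≃* R.PiX)
    (hK : R.thetaKer.map γ.toMonoidHom = R.thetaKer)
    (hL : R.lDeltaTheta.map γ.toMonoidHom = R.lDeltaTheta) (g : R.lDeltaTheta)
    (hg1 : R.thetaMod g = 1) :
    R.thetaMod ⟨γ g, R.apply_mem_of_map_eq γ hL g.2⟩ = 1 := by
  rw [R.thetaMod_ker] at hg1 ⊢
  obtain ⟨k, hk, h, hgk⟩ := hg1
  refine ⟨γ k, R.apply_mem_of_map_eq γ hK hk, ⟨γ h, R.apply_mem_of_map_eq γ hL h.2⟩, ?_⟩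
  change γ (g : R.PiX) = γ k * (γ (h : R.PiX)) ^ (N : ℕ)
  rw [hgk, map_mul, map_pow]

/-- **The coefficient automorphism induced through `thetaMod`**: an automorphism `γ` of `Π^tp_X`
preserving `Ker(Π^tp_X ↠ (Π^tp_X)^Θ)` and the inverse image of `l·Δ_Θ` induces a unique
`γ̄ ∈ Aut(μ_N)`, `μ_N ≅ (l·Δ_Θ) ⊗ ℤ/N`, with `thetaMod (γ g) = γ̄ (thetaMod g)` — the coefficient
automorphism "INDUCED by `γ` on `(l·Δ_Θ) ⊗ ℤ/M ≅ μ_M` (through `thetaMod`, Cor 2.18 (i))" that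
`ThetaEnvTower.Cor219_iii` quantifies over. [cite: MochizukiEtTh2009, Cor 2.19 (iii) p.65] -/
theorem exists_mulEquiv_thetaMod_comp (γ : R.PiX ≃* R.PiX)
    (hK : R.thetaKer.map γ.toMonoidHom = R.thetaKer)
    (hL : R.lDeltaTheta.map γ.toMonoidHom = R.lDeltaTheta) :
    ∃ γμ : R.mu ≃* R.mu, ∀ (g : R.lDeltaTheta) (hg : γ g ∈ R.lDeltaTheta),
      R.thetaMod ⟨γ g, hg⟩ = γμ (R.thetaMod g) := by
  have hK' := R.map_symm_eq_of_map_eq γ hK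
  have hL' := R.map_symm_eq_of_map_eq γ hL
  -- the restrictions of `γ`, `γ⁻¹` to the inverse image of `l·Δ_Θ`
  let ρ : R.lDeltaTheta →* R.lDeltaTheta :=
    (γ.toMonoidHom.comp R.lDeltaTheta.subtype).codRestrict R.lDeltaTheta
      fun g => R.apply_mem_of_map_eq γ hL g.2
  let ρ' : R.lDeltaTheta →* R.lDeltaTheta :=
    (γ.symm.toMonoidHom.comp R.lDeltaTheta.subtype).codRestrict R.lDeltaTheta
      fun g => R.apply_mem_of_map_eq γ.symm hL' g.2
  have hρ : ∀ g : R.lDeltaTheta, ((ρ g : R.lDeltaTheta) : R.PiX) = γ g := fun g => rfl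
  have hρ' : ∀ g : R.lDeltaTheta, ((ρ' g : R.lDeltaTheta) : R.PiX) = γ.symm g := fun g => rfl
  have hρρ' : ∀ g, ρ (ρ' g) = g := fun g => Subtype.ext (by rw [hρ, hρ']; exact γ.apply_symm_apply _)
  have hρ'ρ : ∀ g, ρ' (ρ g) = g := fun g => Subtype.ext (by rw [hρ', hρ]; exact γ.symm_apply_apply _)
  -- `thetaMod ∘ ρ` kills `Ker thetaMod` (and likewise for `ρ'`)
  have hker : R.thetaMod.ker ≤ (R.thetaMod.comp ρ).ker := fun g hg => by
    rw [MonoidHom.mem_ker] at hg ⊢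
    exact R.thetaMod_apply_eq_one γ hK hL g hg
  have hker' : R.thetaMod.ker ≤ (R.thetaMod.comp ρ').ker := fun g hg => by
    rw [MonoidHom.mem_ker] at hg ⊢
    exact R.thetaMod_apply_eq_one γ.symm hK' hL' g hg
  let φ : R.mu →* R.mu := R.thetaMod.liftOfSurjective R.thetaMod_surjective ⟨_, hker⟩
  let φ' : R.mu →* R.mu := R.thetaMod.liftOfSurjective R.thetaMod_surjective ⟨_, hker'⟩
  have hφ : ∀ g, φ (R.thetaMod g) = R.thetaMod (ρ g) := fun g =>
    R.thetaMod.liftOfRightInverse_comp_apply _ _ ⟨_, hker⟩ g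
  have hφ' : ∀ g, φ' (R.thetaMod g) = R.thetaMod (ρ' g) := fun g =>
    R.thetaMod.liftOfRightInverse_comp_apply _ _ ⟨_, hker'⟩ g
  have h1 : φ'.comp φ = MonoidHom.id _ := by
    refine MonoidHom.ext fun m => ?_
    obtain ⟨g, rfl⟩ := R.thetaMod_surjective m
    rw [MonoidHom.comp_apply, hφ, hφ', hρ'ρ, MonoidHom.id_apply]
  have h2 : φ.comp φ' = MonoidHom.id _ := by
    refine MonoidHom.ext fun m => ?_
    obtain ⟨g, rfl⟩ := R.thetaMod_surjective m
    rw [MonoidHom.comp_apply, hφ', hφ, hρρ', MonoidHom.id_apply]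
  refine ⟨MonoidHom.toMulEquiv φ φ' h1 h2, fun g hg => ?_⟩
  change R.thetaMod ⟨γ g, hg⟩ = φ (R.thetaMod g)
  rw [hφ]
  rfl

/-- **Cor. 2.18 (i) ⇒ the coefficient automorphism**: under `Cor218_i` every automorphism of the
topological group `Π^tp_X` induces `γ̄ ∈ Aut(μ_N)` through `thetaMod`.
[cite: MochizukiEtTh2009, Cor 2.18 (i) p.60] -/
theorem exists_mulEquiv_thetaMod_comp_of_cor218_i (h218i : R.Cor218_i) (γ : R.PiX ≃ₜ* R.PiX) :
    ∃ γμ : R.mu ≃* R.mu, ∀ (g : R.lDeltaTheta) (hg : γ g ∈ R.lDeltaTheta),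
      R.thetaMod ⟨γ g, hg⟩ = γμ (R.thetaMod g) := by
  obtain ⟨-, -, -, hK, hL, -⟩ := h218i γ
  exact R.exists_mulEquiv_thetaMod_comp γ.toMulEquiv hK hL

end RigidData

/-! ## The §1 model tower -/

namespace ThetaSetting.EtaleThetaData.DoubleUnderline

variable {p : ℕ} [Fact p.Prime] {D : ThetaSetting p} {E : D.EtaleThetaData} {l : ℕ}
  (C : E.DoubleUnderline l) {Es : Set ℕ+} (τ : D.CyclotomeTower l Es)

/-- **The family `(γ̄_M)_{M ∈ E}` of coefficient automorphisms for the §1 model tower**: under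
Cor. 2.18 (i) for abc-iut-L2-t8's instantiated rigidity data (whose `thetaMod` at level `M` IS the
tower's `thetaMod M`), every automorphism `γ` of `Π^tp_X̲̲` induces automorphisms `γ̄_M` of `μ_M` with
`thetaMod_M (γ g) = γ̄_M (thetaMod_M g)` at all levels — the data `ThetaEnvTower.Cor219_iii` asks for.
[cite: MochizukiEtTh2009, Cor 2.19 (iii) p.65] -/
theorem exists_coeffAut_family (hC : D.Compat) (hS : D.Sec2Hyps) (h15 : Prop15iii E hC)
    (L : C.CuspLabels) (h218i : ∀ M : Es, (C.rigidData (τ.mod M) hC hS h15 L).Cor218_i)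
    (γ : C.Huu ≃ₜ* C.Huu) :
    ∃ γμ : ∀ M : Es, (C.thetaEnvTower τ hC hS).mu M ≃* (C.thetaEnvTower τ hC hS).mu M,
      ∀ (M : Es) (g : (C.thetaEnvTower τ hC hS).lDeltaTheta)
        (hg : γ g ∈ (C.thetaEnvTower τ hC hS).lDeltaTheta),
        (C.thetaEnvTower τ hC hS).thetaMod M ⟨γ g, hg⟩ =
          γμ M ((C.thetaEnvTower τ hC hS).thetaMod M g) := by
  have key : ∀ M : Es, ∃ γμ : (C.thetaEnvTower τ hC hS).mu M ≃* (C.thetaEnvTower τ hC hS).mu M,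
      ∀ (g : (C.thetaEnvTower τ hC hS).lDeltaTheta)
        (hg : γ g ∈ (C.thetaEnvTower τ hC hS).lDeltaTheta),
        (C.thetaEnvTower τ hC hS).thetaMod M ⟨γ g, hg⟩ =
          γμ ((C.thetaEnvTower τ hC hS).thetaMod M g) := fun M =>
    (C.rigidData (τ.mod M) hC hS h15 L).exists_mulEquiv_thetaMod_comp_of_cor218_i (h218i M) γ
  choose γμ hγμ using key
  exact ⟨γμ, hγμ⟩

/-- **The constant-multiple-rigidity input `hcoll` of Cor. 2.18 (iv) (surjectivity) for the §1 model,
FROM THE NAMED FACT `ThetaEnvTower.Cor219_iii`**: at every level `M ∈ E`, for every automorphism `γ`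
of `Π^tp_X̲̲` preserving `Π^tp_Y̲̲` there are `ψ ∈ Aut(μ_M)` and, for each theta cocycle `η`, a theta
cocycle `η''` and a continuous `G_K`-inflated Kummer cocycle `c` with
`ψ(η(d)) = η''(γ d) · c(aug(γ d))` — obtained from Cor. 2.19 (iii) applied to `γ⁻¹` with the
coefficient automorphisms `γ̄_M` of Cor. 2.18 (i) (`ψ := γ̄_M⁻¹`). This is literally the binder
`hcoll` of abc-iut-L2-t10's `RigidData.cor218_iv_surjective_of` (`Sec2LiftingSurjProofs.lean`).
[cite: MochizukiEtTh2009, Cor 2.18 (iv) p.61] -/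
theorem hcoll_of_cor219_iii (hC : D.Compat) (hS : D.Sec2Hyps) (h15 : Prop15iii E hC)
    (L : C.CuspLabels) (h218i : ∀ M : Es, (C.rigidData (τ.mod M) hC hS h15 L).Cor218_i)
    (h219iii : (C.thetaEnvTower τ hC hS).Cor219_iii) (M : Es)
    (γ : (C.rigidData (τ.mod M) hC hS h15 L).PiX ≃ₜ* (C.rigidData (τ.mod M) hC hS h15 L).PiX)
    (_hγ : (C.rigidData (τ.mod M) hC hS h15 L).PiY.map γ.toMulEquiv.toMonoidHom =
      (C.rigidData (τ.mod M) hC hS h15 L).PiY) :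
    ∃ ψ : (C.rigidData (τ.mod M) hC hS h15 L).mu ≃* (C.rigidData (τ.mod M) hC hS h15 L).mu,
      ∀ (η : (C.rigidData (τ.mod M) hC hS h15 L).PiYdd → (C.rigidData (τ.mod M) hC hS h15 L).mu),
        η ∈ (C.rigidData (τ.mod M) hC hS h15 L).thetaCocycles →
        ∃ (η'' : (C.rigidData (τ.mod M) hC hS h15 L).PiYdd → (C.rigidData (τ.mod M) hC hS h15 L).mu)
          (_ : η'' ∈ (C.rigidData (τ.mod M) hC hS h15 L).thetaCocycles)
          (c : (C.rigidData (τ.mod M) hC hS h15 L).G → (C.rigidData (τ.mod M) hC hS h15 L).mu)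
          (hc : CycEnvelope.IsEnvCocycle (C.rigidData (τ.mod M) hC hS h15 L).augY
            (C.rigidData (τ.mod M) hC hS h15 L).chi (c ∘ (C.rigidData (τ.mod M) hC hS h15 L).augY))
          (_ : CycEnvelope.shift hc ∈ contMulAut (C.rigidData (τ.mod M) hC hS h15 L).env),
          ∀ d d' : (C.rigidData (τ.mod M) hC hS h15 L).PiYdd,
            γ (d : (C.rigidData (τ.mod M) hC hS h15 L).PiX) = d' →
            ψ (η d) = η'' d' * c ((C.rigidData (τ.mod M) hC hS h15 L).augY
              ((C.rigidData (τ.mod M) hC hS h15 L).inclYdd d')) := by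
  -- preservation facts for `γ⁻¹` (Cor 2.18 (i))
  obtain ⟨-, hdd', -, -, -, -⟩ := h218i M γ.symm
  -- coefficient automorphisms of `γ⁻¹` at all levels, and Cor 2.19 (iii) for `γ⁻¹`
  obtain ⟨γμ, hγμ⟩ := C.exists_coeffAut_family τ hC hS h15 L h218i γ.symm
  obtain ⟨c, hcoc, hlc, -, himg⟩ := h219iii γ.symm hdd' γμ hγμ
  refine ⟨(γμ M).symm, fun η hη => ?_⟩
  have hmem : (C.thetaEnvTower τ hC hS).pullbackCocycle M γ.symm hdd' (γμ M) η ∈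
      (fun η₁ => η₁ * (c M ∘ (C.thetaEnvTower τ hC hS).aug ∘
        (C.thetaEnvTower τ hC hS).PiYdd.subtype)) '' (C.thetaEnvTower τ hC hS).thetaCocycles M := by
    rw [← himg M]
    exact ⟨η, hη, rfl⟩
  obtain ⟨η₁, hη₁, heq⟩ := hmem
  have hcont : Continuous (c M ∘ (C.rigidData (τ.mod M) hC hS h15 L).augY) :=
    (hlc M).continuous.comp continuous_subtype_val
  refine ⟨η₁, hη₁, c M, (hcoc M).comp _,
    (C.thetaEnvTower τ hC hS).shift_mem_contMulAut M _ hcont,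
    fun d d' hdd => ?_⟩
  have h1 := congrFun heq d'
  simp only [Pi.mul_apply, Function.comp_apply, ThetaEnvTower.pullbackCocycle] at h1
  have hmemd : γ.symm (d' : (C.rigidData (τ.mod M) hC hS h15 L).PiX) ∈
      (C.rigidData (τ.mod M) hC hS h15 L).PiYdd := by
    rw [← hdd, ContinuousMulEquiv.symm_apply_apply]; exact d.2
  have hd : d = ⟨γ.symm (d' : (C.rigidData (τ.mod M) hC hS h15 L).PiX), hmemd⟩ :=
    Subtype.ext (by rw [← γ.symm_apply_apply (d : (C.rigidData (τ.mod M) hC hS h15 L).PiX), hdd])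
  rw [hd]
  exact h1.symm

end ThetaSetting.EtaleThetaData.DoubleUnderline

end Literature.AnabelianGeometry.EtaleTheta

end
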